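import Summits.QuantumFields.QCD.Theses.HeatSlicedQuarks
import Summits.QuantumFields.QCD.Theses.GapBuysCauchyRate
import Summits.QuantumFields.QCD.Theorems.HeatSlicedQuarksInterleavedFlowProperStubFormatHandover
import Summits.QuantumFields.QCD.Theorems.HeatSlicedQuarksInterleavedFlowProperStubPolynomialFiniteRange
import Summits.QuantumFields.QCD.Theorems.HeatSlicedQuarksInterleavedFlowProperStubPsdGramHadamardDet
import Summits.QuantumFields.QCD.Theorems.HeatSlicedQuarksInterleavedFlowProperStubFrPiecesSumNorm
import Summits.QuantumFields.QCD.Theorems.HeatSlicedQuarksInterleavedFlowProperStubFrPiecesSFU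
import Summits.QuantumFields.QCD.Theorems.HeatSlicedQuarksInterleavedFlowProperStubOsDataAlongFullSequence
import Summits.QuantumFields.QCD.Theorems.HeatSlicedQuarksInterleavedHeatSliceFlowCollapse
import Summits.QuantumFields.QCD.Theorems.RobustYangMillsHandover.Negative.GapClauses
import Literature.MathematicalPhysics.QuantumFieldTheory.QCDCalibratedSpecies
import Literature.LinearAlgebra.Matrix.FiniteRangeDecompositionMatrixSum
import Literature.LinearAlgebra.Matrix.FiniteRangeDecompositionMatrixBounds

/-!
# Line `finite-range-heat-slices` — skeleton gen 4 for crux stmt-QuantumFields-18031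
# `Summit.QuantumFields.QCD.Theses.HeatSlicedQuarks.InterleavedFlowProper` (lead a1, end of cycle 1)

`InterleavedFlowProper := TracedQuadraticParametrix → QuarkLoopCoefficient → InterleavedHeatSliceFlow` and
`InterleavedHeatSliceFlow ↔ ContinuumQCDExists` (p96451); both milestones are theorems, so the crux is ≡ X₀ (p158714).  The line is
a DESIGN FOR X₀ honouring R1–R4 of `Lines/Sketch-dead.md` (ONE threaded witness `(reg, 𝒞)`, UV output in X₀'s vocabulary, IR residue
as NAMED stubs).

History: gen 1 (crux-plan, 13:59Z) six stubs · gen 2 (lead a1, 14:43Z) FORMAT stubs split into unfolded registered helpers · gen 3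
(15:3xZ) FORMAT helpers LANDED and imported, `OSClosureFR` RESHAPED after worker B6's `stub-misstated` finding (E2 cannot follow from
hypotheses on the time-PERIODIC twisted trace `qcdLatticeSchwinger`; fix = the repaired typing R′ of the sibling crux 11525: (T)
`HasUniformDistBound` in the UV block, (COMP) `HasThermalComparison` + (CL) `HasTimeOrderedClustering` in the IR block) and PROVED;
E1 reduced to item 8840 in one line · gen 4 (this file): the package vocabulary (`IsLimitFamily`, …, `FRFlowPackage`,
`RotationRestorationFR`, `OSClosureFR`) and the two soft stubs as theorems (`stub_osDataAlongFullSequence : OSClosureFR`,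
`rotationRestorationFR_of_rotationRestoration`) are IMPORTED from the landed
`Theorems/HeatSlicedQuarksInterleavedFlowProperStubOsDataAlongFullSequence.lean` (p169153); the FORMAT stubs from
`…StubPsdGramHadamardDet` (p167533), `…StubFrPiecesSumNorm` (p168253), `…StubFrPiecesSFU` (p168681, `…SFUAux` p168492).

OPEN (sorries ONLY here) — the crux is closed modulo exactly these three named statements:
* `stub_frFlow : FRFlow` — the line's own declared X₀-hard residue (the interleaved boson ⊕ fermion finite-range flow for ONE
  threaded `(reg, 𝒞)` in the heavy corner; no precedent in print);
* `stub_ymLatticeGapAlongAF : YMLatticeGapAlongAFSequences` — item stmt-QuantumFields-8796 VERBATIM (other route's seat);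
* `stub_rotationRestoration8840 : Theses.GapBuysCauchyRate.RotationRestoration` — item stmt-QuantumFields-8840 BY NAME.
`InterleavedFlowProper_of` / `interleavedFlowProper_from_stubs` conclude the crux BY NAME (pure logic, no sorry outside the stubs).
-/

noncomputable section

namespace Summit.QuantumFields.QCD.Cruxes.InterleavedFlowProper.FiniteRangeHeatSlices

open scoped BigOperators Matrix ComplexOrder SchwartzMap
open Filter Topology
open Literature.MathematicalPhysics.QuantumFieldTheory Literature.MathematicalPhysics.QuantumLattice
  Literature.MathematicalPhysics.AQFT
open Literature.Probability.LatticeModels (TorusSite)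
open Literature.LinearAlgebra.Matrix (MatrixFRD.piece)
open Summit.QuantumFields.QCD.Theses.HeatSlicedQuarks
open Summit.QuantumFields.QCD.Cruxes.StableActionBridge.Sketch (qcdLatticeDist qcdLatticeDistSymAP)

local notation "𝔾" => Matrix.specialUnitaryGroup (Fin 3) ℂ

/-! ## §0 The objects: the massive Wilson square and its Bauerschmidt pieces -/

/-- Quark field index on the torus of side `L`: site × colour × spin (as in the route file). -/
abbrev Idx (L : ℕ) : Type := TorusSite 4 L × Fin 3 × Fin 4

/-- The Wilson–Dirac matrix `D_W(U, m, r = 1)` of the route. -/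
abbrev dW (L : ℕ) [NeZero L] (U : GaugeConfig 4 L 𝔾) (m : ℝ) : Matrix (Idx L) (Idx L) ℂ :=
  wilsonDirac (fundamentalRep (Fin 3)) U m 1

/-- The MASSIVE WILSON SQUARE `Q_U(μ) = D_Wᴴ D_W + μ²` (the engine's generator `H_U` plus the infrared
regulator `μ²` — in the flow `μ` is the RENORMALISED quark mass in lattice units, triage r1-2 sharpen (4)). -/
def massiveWilsonSquare (L : ℕ) [NeZero L] (U : GaugeConfig 4 L 𝔾) (m μ : ℝ) : Matrix (Idx L) (Idx L) ℂ :=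
  (dW L U m)ᴴ * dW L U m + ((μ : ℂ) ^ 2) • (1 : Matrix (Idx L) (Idx L) ℂ)

/-- The `n`-th FINITE-RANGE HEAT SLICE of the quark Green form: Bauerschmidt's piece `C_n = g_n(Q_U(μ))` with
scale ratio `2` and spectral bound `Θ` — the tree's `MatrixFRD.piece` (PSD by `piece_posSemidef`, exact range
`2ⁿ` in torus distance by `piece_apply_eq_zero_of_lt_dist` since `Q_U(μ)` hops twice, for EVERY `U`). -/
def frSlice (Θ : ℝ) (n : ℕ) (L : ℕ) [NeZero L] (U : GaugeConfig 4 L 𝔾) (m μ : ℝ) :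
    Matrix (Idx L) (Idx L) ℂ :=
  MatrixFRD.piece (massiveWilsonSquare L U m μ) Θ 2 n

/-! ## §1 FORMAT STUB 1 — finite-range heat slices with SFU power counting (first lemma of the card, retyped) -/

/-- **`FRHeatSlices`** (card `finite-range-heat-slices`, first lemma RETYPED after the triage junk finding: the
pieces are the CONCRETE Literature pieces, quantified before nothing, every piece bounded, constants uniform in
`μ ∈ (0,1]`, `L`, `U`, `m`).  There are `ε > 0`, `K`, a spectral bound `Θ > 0` and `C` such that for every
`μ ∈ (0,1]`, torus side `L`, `SU(3)` field `U`, bare mass `m ∈ [−1/2,1]`: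
(sum) `Σ_n C_n = Q_U(μ)⁻¹` (`HasSum`; the top piece vanishes in the limit since `Q_U(μ) ≥ μ² > 0`);
(mass decay, ℓ² operator form) `‖C_n v‖₂ ≤ C·4ⁿ(1 + μ²4ⁿ)⁻³‖v‖₂` (Bauerschmidt Thm 1.2 `‖Φ_t‖ ≤ Ct²` with the
`P_t`-lemma decay, tree `MatrixFRD.exists_gFun_le_majorant`);
(SFU power counting) on every ball on which the plaquettes are `(ε/r²)²`-small at a scale `r ≥ 2ⁿ` — the hypothesis
of the PROVED crux `SmallFieldUltracontractivity` 8871 — the on-diagonal entries of `C_n` are `≤ C/4ⁿ` and those of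
the SANDWICHED piece `D_W C_n D_Wᴴ = g_n(D_W D_Wᴴ + μ²)·D_W D_Wᴴ` are `≤ C/16ⁿ + Cμ²/4ⁿ` (local `(H_{4,ω})` from
8871 by Γ-subordination `(1+t²λ)⁻ˡ = Γ(l)⁻¹∫e⁻ˢsˡ⁻¹e^{−st²λ}ds`, monotonicity of `u ↦ e^{−uH}(x,x)` beyond the
window, entries `≤ 1` below `t = 1`, and `γ₅`-hermiticity `D Dᴴ = Γ₅ Dᴴ D Γ₅` for the sandwiched operator).
Together with PSD (Literature) and Gram–Hadamard (`PSDGramHadamard`) this gives the sliced fermionic covariance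
`C_n D_Wᴴ` Gram constants `√(4⁻ⁿ)·√(16⁻ⁿ) = 8⁻ⁿ = (range)⁻³` — free Dirac power counting, NO analyticity.
[Bauerschmidt arXiv:1206.2212 Thm 1.2, Lemma 2.1/2.7; BBS LNM 2242 Ch. 3; route items 8871, 8876] -/
def FRHeatSlices : Prop :=
  ∃ ε : ℝ, 0 < ε ∧ ∃ K : ℕ, ∃ Θ : ℝ, 0 < Θ ∧ ∃ C : ℝ, ∀ μ : ℝ, μ ∈ Set.Ioc (0 : ℝ) 1 →
    ∀ (L : ℕ) [NeZero L] (U : GaugeConfig 4 L 𝔾) (m : ℝ), m ∈ Set.Icc (-(1 / 2 : ℝ)) 1 →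
      HasSum (fun n : ℕ => frSlice Θ n L U m μ) (massiveWilsonSquare L U m μ)⁻¹ ∧
      (∀ (n : ℕ) (v : Idx L → ℂ),
        ∑ i, ‖(frSlice Θ n L U m μ).mulVec v i‖ ^ 2 ≤
          (C * 4 ^ n * ((1 + μ ^ 2 * 4 ^ n)⁻¹) ^ 3) ^ 2 * ∑ i, ‖v i‖ ^ 2) ∧
      ∀ (n : ℕ) (x : TorusSite 4 L) (r : ℕ), 2 ^ n ≤ r → r ≤ L →
        (∀ y : TorusSite 4 L, torusDist x y ≤ K * r → ∀ μ' ν' : Fin 4,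
          3 - ((fundamentalRep (Fin 3)) (plaquetteHolonomy U y μ' ν')).trace.re ≤ (ε / (r : ℝ) ^ 2) ^ 2) →
        ∀ (a : Fin 3) (α : Fin 4),
          ‖frSlice Θ n L U m μ (x, a, α) (x, a, α)‖ ≤ C / 4 ^ n ∧
          ‖(dW L U m * frSlice Θ n L U m μ * (dW L U m)ᴴ) (x, a, α) (x, a, α)‖ ≤ C / 16 ^ n + C * μ ^ 2 / 4 ^ n

/-! ## §2 FORMAT STUB 2 — Gram–Hadamard for positive-semidefinite-sliced pairings (Pauli in the norm) -/

/-- **`PSDGramHadamard`** (the card's "Gram is positivity of `Φ_j`, no analyticity at all", as a lemma): for a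
positive semi-definite `Φ` and ANY matrix `D` on a finite index set, every `n × n` minor of the pairing kernel
`Φ Dᴴ` taken at rows `x₁ … xₙ` and columns `y₁ … yₙ` obeys
`|det[(Φ Dᴴ)(xᵢ, yⱼ)]| ≤ ∏ᵢ √(Φ(xᵢ,xᵢ)) · ∏ⱼ √((D Φ Dᴴ)(yⱼ,yⱼ))`
— Gram factorisation `(ΦDᴴ)(x,y) = ⟨Φ^{1/2}δ_x, Φ^{1/2}Dᴴδ_y⟩` plus Hadamard/Cauchy–Binet.  With `Φ = C_n` and
`D = D_W` this is the determinant bound of the sliced quark covariance the fermionic expectation needs (no `n!`).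
[Gram–Hadamard; GK doi:10.1007/bf01208817, FMRS doi:10.1007/bf01464282 (Gram bounds for fermions)] -/
def PSDGramHadamard : Prop :=
  ∀ (ι : Type) [Fintype ι] [DecidableEq ι] (Φ D : Matrix ι ι ℂ), Φ.PosSemidef →
    ∀ (n : ℕ) (x y : Fin n → ι),
      ‖(Matrix.of fun i j => (Φ * Dᴴ) (x i) (y j)).det‖ ≤
        (∏ i, Real.sqrt ((Φ (x i) (x i)).re)) * ∏ j, Real.sqrt (((D * Φ * Dᴴ) (y j) (y j)).re)

/-! ## §3 The flow — the one package-level stub statement that is NOT imported (its witnesses are the line's open content) -/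

/-- **`FRFlow` — THE INTERLEAVED FLOW IN FINITE-RANGE FORMAT** (the crux's content (i)–(iii) and the convergence
half of (iv); the declared X₀-hard residue, now typed): from the two FORMAT lemmas (finite-range PSD slices with
SFU power counting; Gram–Hadamard) and the two MILESTONES (`TracedQuadraticParametrix`: the background correction
is O(δ²), i.e. belongs to the irrelevant coordinate `K`; `QuarkLoopCoefficient`: the universal number `1/(6π²)·P`
the flow of `1/g²` picks up per octave), for `N_f = 2, 3` there are an offset `M₀ ≥ 0`, ONE regularisation `reg`
with leading-log `HasMassScaling` and ONE calibrated family `𝒞` with `FRFlowPackage reg 𝒞 M₀`.  Mechanism: BBS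
single-norm boson ⊕ fermion RG (arXiv:1403.7244/7255/7256) over Bałaban's block geometry in the heavy corner
(`afBeta ≥ β_*` on every fermion-active scale), pieces `C_n = g_n(H_{U_j} + μ_j²)` with `μ_j` the RUNNING
renormalised mass (zero modes of `H_U` at negative bare mass sit in the top pieces as `μ⁻²`), `−N_f log det`
sliced as `Σ_n Tr g_n` (closed quark-hopping loops of range `≤ 2ⁿ`), `m_crit(k)` by finite-horizon shooting.
HONEST BET (card Barriers, triage F3): the gauge half — Haar fluctuation fields with regulator `e^{κβS_W}`,
`κ < 1` uniformly in `β` — has no non-abelian precedent; if it fails the statement is still the target of the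
REDUCED lever (finite-range Gram slices inside Bałaban's expansion), the package typing being format-agnostic. -/
def FRFlow : Prop :=
  FRHeatSlices → PSDGramHadamard → TracedQuadraticParametrix → QuarkLoopCoefficient →
    ∀ Nf : ℕ, Nf = 2 ∨ Nf = 3 → ∃ M₀ : ℝ, 0 ≤ M₀ ∧ ∃ reg : QCDRegularisation Nf, reg.HasMassScaling ∧
      ∃ 𝒞 : CalibratedSpeciesFamily reg, FRFlowPackage reg 𝒞 M₀

/-! ## §4 The registered stubs (sorries ONLY here) -/

/-- Registered stub (THE FLOW, X₀-hard residue of the route, declared): the interleaved flow in finite-range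
format delivers the UV package for one threaded `(reg, 𝒞)` above an offset. -/
theorem stub_frFlow : FRFlow := by
  sorry

/-- Registered stub (IR IMPORT = item stmt-QuantumFields-8796 VERBATIM: the N_f = 0 SU(3) Wilson lattice gap along every
two-loop AF sequence, uniformly in the volume; another route's ∀-typed item with its own seat). -/
theorem stub_ymLatticeGapAlongAF : YMLatticeGapAlongAFSequences := by
  sorry

/-- Registered stub (E1 IMPORT = item stmt-QuantumFields-8840 BY NAME: rotation restoration for gapped AF schemes; another
route's item).  `RotationRestorationFR` follows from it in one line (`stub_rotationInvariantLimits`, worker B5's kernel-checked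
term). -/
theorem stub_rotationRestoration8840 : Theses.GapBuysCauchyRate.RotationRestoration := by
  sorry

/-! ## §5 Stub statements that are now THEOREMS (FORMAT 1, FORMAT 2, E1; the OS closure `stub_osDataAlongFullSequence` is imported) -/

/-- Registered stub (FORMAT 1): finite-range heat slices with SFU power counting — ASSEMBLED from the two registered
helpers `stub_frPiecesSumNorm` (sum + mass decay) and `stub_frPiecesSFU` (SFU power counting) at the
explicit spectral bound `Θ = 64` (`‖D_W‖ ≤ |m+4|+4 ≤ 9`, so `spec Q_U(μ) ⊂ [μ², 82] ⊂ [0, 2Θ]`). -/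
theorem stub_finiteRangeHeatSlices : FRHeatSlices := by
  obtain ⟨C₁, h₁⟩ := stub_frPiecesSumNorm
  obtain ⟨ε, hε, K, C₂, h₂⟩ := stub_frPiecesSFU
  refine ⟨ε, hε, K, 64, by norm_num, max (max |C₁| |C₂|) 1, fun μ hμ L _ U m hm => ?_⟩
  have hQ : massiveWilsonSquare L U m μ = (dW L U m)ᴴ * dW L U m +
      ((μ : ℂ) ^ 2) • (1 : Matrix (Idx L) (Idx L) ℂ) := rfl
  obtain ⟨hsum, hnorm⟩ := h₁ μ hμ L U m hm (massiveWilsonSquare L U m μ) hQ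
  have hsfu := h₂ μ hμ L U m hm (massiveWilsonSquare L U m μ) hQ
  set C : ℝ := max (max |C₁| |C₂|) 1 with hC
  have hC1 : |C₁| ≤ C := (le_max_left _ _).trans (le_max_left _ _)
  have hC2 : C₂ ≤ C := ((le_abs_self C₂).trans (le_max_right _ _)).trans (le_max_left _ _)
  have hC0 : 0 ≤ C := zero_le_one.trans (le_max_right _ _)
  refine ⟨hsum, fun n v => ?_, fun n x r hr hrL hsmall a α => ?_⟩
  · refine (hnorm n v).trans ?_
    have hv : 0 ≤ ∑ i, ‖v i‖ ^ 2 := Finset.sum_nonneg fun i _ => by positivity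
    apply mul_le_mul_of_nonneg_right _ hv
    have hX : 0 ≤ (4 : ℝ) ^ n * ((1 + μ ^ 2 * 4 ^ n)⁻¹) ^ 3 := by positivity
    have h1 : |C₁ * 4 ^ n * ((1 + μ ^ 2 * 4 ^ n)⁻¹) ^ 3| ≤ |C * 4 ^ n * ((1 + μ ^ 2 * 4 ^ n)⁻¹) ^ 3| := by
      have e1 : C₁ * 4 ^ n * ((1 + μ ^ 2 * 4 ^ n)⁻¹) ^ 3 = C₁ * (4 ^ n * ((1 + μ ^ 2 * 4 ^ n)⁻¹) ^ 3) := by ring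
      have e2 : C * 4 ^ n * ((1 + μ ^ 2 * 4 ^ n)⁻¹) ^ 3 = C * (4 ^ n * ((1 + μ ^ 2 * 4 ^ n)⁻¹) ^ 3) := by ring
      rw [e1, e2, abs_mul, abs_of_nonneg hX, abs_of_nonneg (mul_nonneg hC0 hX)]
      exact mul_le_mul_of_nonneg_right hC1 hX
    exact sq_le_sq.mpr h1
  · obtain ⟨hd, hs⟩ := hsfu n x r hr hrL hsmall a α
    refine ⟨hd.trans (div_le_div_of_nonneg_right hC2 (by positivity)), hs.trans ?_⟩
    have hμ2 : 0 ≤ μ ^ 2 := sq_nonneg μ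
    gcongr

/-- Registered stub (FORMAT 2): Gram–Hadamard for PSD-sliced pairings, from the registered helper
`stub_psdGramHadamardDet` (its unfolded body). -/
theorem stub_psdGramHadamard : PSDGramHadamard :=
  fun ι _ _ Φ D hΦ n x y => stub_psdGramHadamardDet ι Φ D hΦ n x y

/-- gen-1/2 stub `stub_rotationInvariantLimits : RotationRestorationFR`, DERIVED from item 8840 by name via the landed one-line
reduction `rotationRestorationFR_of_rotationRestoration` (p169153). -/
theorem stub_rotationInvariantLimits : RotationRestorationFR :=
  rotationRestorationFR_of_rotationRestoration stub_rotationRestoration8840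

/-! ## §6 Composition (kernel-checked, no sorry): the six stub statements close the crux BY NAME -/

/-- The threshold form used by the landing pad IS the tree's inline threshold form of X₀. -/
theorem continuumQCDExists_of_threshold (h : OffsetLastFormatHandover.ThresholdContinuumQCDExists) :
    ContinuumQCDExists :=
  Theorems.RobustYangMillsHandover.Negative.continuumQCDExists_iff_threshold.mpr h

/-- **The stub statements give `QCDLimitsAlongOneSubsequence` with the IDENTITY extraction** (full-sequence
convergence: no compactness, no diagonal argument; the threaded `(reg, 𝒞)` of `FRFlow` is the witness). -/
theorem limitsAlong_of_stubs (h1 : FRHeatSlices) (h2 : PSDGramHadamard) (h3 : FRFlow)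
    (h4 : YMLatticeGapAlongAFSequences) (h5 : RotationRestorationFR)
    (h6 : OSClosureFR) (hTQP : TracedQuadraticParametrix) (hQLC : QuarkLoopCoefficient) :
    OffsetLastFormatHandover.QCDLimitsAlongOneSubsequence := by
  intro Nf hNf
  obtain ⟨M₀, hM₀, reg, hms, 𝒞, hpkg⟩ := h3 h1 h2 hTQP hQLC Nf hNf
  obtain ⟨has, hUV, hIR⟩ := hpkg
  refine ⟨M₀, hM₀, reg, hms, has, id, strictMono_id, fun m hm => ?_⟩
  obtain ⟨hbr, -, -, -⟩ := hUV m hm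
  obtain ⟨Δ, hΔ, hgap, hCOMP, hcl, hcauchy⟩ := hIR h4 m hm
  have hrot : ∀ S : LabelledSchwingerFamily (QCDField Nf) (EuclideanSpace ℝ (Fin 4)),
      IsLimitFamily (𝒞.scheme m) S → IsRotationInvariant S :=
    h5 Nf hNf reg 𝒞 M₀ ⟨has, hUV, hIR⟩ m hm ⟨Δ, hΔ, hgap⟩
  obtain ⟨T, hconv, hN, hG, hP⟩ :=
    h6 Nf hNf reg 𝒞 M₀ ⟨has, hUV, hIR⟩ m hm hCOMP hcl hcauchy hrot
  refine ⟨hbr, 𝒞.z m, 𝒞.shift m, T, ?_, hN, hG, hP⟩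
  intro n hn σ f F hF hoff
  exact hconv n hn σ f F hF hoff

/-- **Composition**: the stub statements close the crux `InterleavedFlowProper` BY NAME — via the landed
landing pad (p147381), offset-blindness of X₀, and the collapse `InterleavedHeatSliceFlow ↔ ContinuumQCDExists`
(p96451).  The crux's own hypotheses `TracedQuadraticParametrix`, `QuarkLoopCoefficient` are consumed by `FRFlow`. -/
theorem InterleavedFlowProper_of :
    FRHeatSlices → PSDGramHadamard → FRFlow → YMLatticeGapAlongAFSequences →
      RotationRestorationFR → OSClosureFR → InterleavedFlowProper := by
  intro h1 h2 h3 h4 h5 h6 hTQP hQLC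
  have hlim : OffsetLastFormatHandover.QCDLimitsAlongOneSubsequence :=
    limitsAlong_of_stubs h1 h2 h3 h4 h5 h6 hTQP hQLC
  have hX₀ : ContinuumQCDExists :=
    continuumQCDExists_of_threshold (OffsetLastFormatHandover.thresholdContinuumQCDExists_of_limitsAlong hlim)
  exact Cruxes.InterleavedHeatSliceFlow.interleavedHeatSliceFlow_iff_continuumQCDExists.mpr hX₀

/-- The crux itself, from the registered stubs (open: `stub_frFlow`, `stub_ymLatticeGapAlongAF` = 8796,
`stub_rotationRestoration8840` = 8840; theorems: the two FORMAT stubs, the rotation reduction, the OS closure). -/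
theorem interleavedFlowProper_from_stubs : InterleavedFlowProper :=
  InterleavedFlowProper_of stub_finiteRangeHeatSlices stub_psdGramHadamard stub_frFlow stub_ymLatticeGapAlongAF
    stub_rotationInvariantLimits stub_osDataAlongFullSequence

end Summit.QuantumFields.QCD.Cruxes.InterleavedFlowProper.FiniteRangeHeatSlices

end
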